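import Literature.Probability.RandomPlanarGeometry.SAWAdsorptionFreeEnergyFunction
import HarnessLib

/-!
# Low-temperature behaviour of the adsorbing half-plane self-avoiding walk on `ℤ²`:
# `a ≤ e^{κ(a)} ≤ a + 2` for `a ≥ 1`, hence `e^{κ(a)} ∼ a` and `0 ≤ κ(α) − α ≤ 2e^{−α}`

Topic `Literature/Probability/RandomPlanarGeometry` (continues `SAWAdsorptionFreeEnergyFunction.lean`: the adsorption
partition function `Zd.adsZ n a = Z⁺_n(a) = Σ_ω a^{#wall visits}` over `n`-step self-avoiding walks in the half-plane
`x₀ ≥ 0` from the origin, its growth rate `Zd.adsRate a = e^{κ(a)} = lim Z⁺_n(a)^{1/n}`, the free energy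
`Zd.adsFreeEnergy α = κ(α) = log e^{κ}(e^α)` and the critical fugacity `Zd.adsCriticalFugacity = a_c`).

Status in print. The window `a ≤ e^{κ(a)} ≤ μ·a` (`a ≥ 1`): Janse van Rensburg–Whittington 2013, §3.1 eq. (3.1)
(arXiv:1307.6457v4 p. 6, after Hammersley–Torrie–Whittington 1982) «max{log μ_d, log μ_{d−1} + log a} ≤ κ(a) ≤
log μ_d + log a» (at `d = 2`, `μ₁ = 1`); Owczarek–Whittington 2009 §12.2.1 (12.15) «max[κ₂, α] ≤ κ(α) ≤ κ₂ + α»;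
Beaton–Guttmann–Jensen 2012 p. 2 «κ(α) ≥ max[log μ, α]» — in the tree as `Zd.OwczarekWhittington2009_eq_12_15`. The
first-order law `e^{κ(a)} ∼ a` on the square lattice is Rychlewski–Whittington 2011 (J. Stat. Phys. 145, 661–668; primary
source not held by the lane) AS REPORTED: «The behaviour of `μ(y)` as `y → ∞` has recently been established by Rychlewski
and Whittington [23], who proved that, on the square lattice, `μ(y)` is asymptotic to `y`» (Beaton–Bousquet-Mélou–de Gier–
Duminil-Copin–Guttmann, arXiv:1109.0358v5 pp. 9–10; `μ(y)` = the growth rate `e^{κ}` at surface fugacity `y`) and «[RW11]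
… proved that `κ(α)` is asymptotic to `α` in this regime» (BGJ 2012, arXiv:1110.6695v1 p. 2); the held PROVED statements
are ratio asymptotics: Janse van Rensburg–Whittington 2013 Theorem 4 (v4 p. 8), Corollary 1 and Theorem 5 (p. 9) «κ(a) is
asymptotic to log μ_{d−1} + log a for large a» in the sense «log μ_{d−1} + log a ≤ κ(a) ≤ log μ_{d−1} + (1+δ) log a for
a > a_δ» (the tree's `Zd.tendsto_adsFreeEnergy_div`, `κ(α)/α → 1`, is its `d = 2` reading). The uniform bound
`e^{κ(a)} ≤ a + 2` (sharper than (3.1)/(12.15) exactly for `a > 2/(μ−1) ≈ 1.22`) and the rate `0 ≤ κ(α) − α ≤ 2e^{−α}`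
are not located in print.

## Statements (this file; pure standard axioms)

* `Zd.adsZ_le_three_mul_add_two_pow` — **`Z⁺_n(a) ≤ 3 (a+2)ⁿ` for every `n` and every `a ≥ 1`** (finite, explicit);
* `Zd.adsRate_le_add_two` — **`e^{κ(a)} ≤ a + 2` for `a ≥ 1`**; with `Zd.self_le_adsRate` this is the sandwich
  **`a ≤ e^{κ(a)} ≤ a + 2` on `[1, ∞)`** (`Zd.adsRate_mem_Icc`); `Zd.adsRate_le_add_three` — `e^{κ(a)} ≤ a + 3`, all `a ≥ 0`;
* `Zd.tendsto_adsRate_div_self` — **`e^{κ(a)}/a → 1` as `a → ∞`** («`μ(y)` is asymptotic to `y`», the printed RW11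
  statement for the square lattice), and `Zd.tendsto_adsFreeEnergy_sub_self` — **`κ(α) − α → 0`** (`= log μ(ℤ¹) = 0`);
* `Zd.adsFreeEnergy_sub_le_log` / `Zd.adsFreeEnergy_sub_le` — **`0 ≤ κ(α) − α ≤ log (1 + 2e^{−α}) ≤ 2e^{−α}`**, `α ≥ 0`.

## Mechanism (`Zd.LowTemp`)

A half-plane self-avoiding walk is the trajectory of a unique step word (`SAWWords`); such a word has no immediate
reversal and a non-negative height profile. On ALL words with these two properties, read from a configuration
`(h, l)` = (current height, last step), weight each arrival on the wall `x₀ = 0` by `a` and the final configuration by a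
potential `u`; if `u` is `Λ`-excessive for the one-step rule (`LowTemp.locSum u a h l ≤ Λ · u h l` for `h ≥ 0`) then the
potential-weighted sum over words of length `n` is at most `Λⁿ u(0, start)` (`LowTemp.sum_words_le`), whence
`Z⁺_n(a) ≤ Λⁿ u(0,start)/δ` when `u ≥ δ` (`Zd.adsZ_le_of_potential`). The potential `LowTemp.pot` — `1/2` inside a wall
run, `a/(a+2)` just after landing, `1` off the wall — is `(a+2)`-excessive for `a ≥ 1` (`LowTemp.locSum_pot_le`, a
finite case analysis): a wall run has ONE continuation on the wall, the letters leaving and reaching the wall are forced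
(`+e₀` / `−e₀`), and only a landing is followed by a two-way choice. This is where the factor `μ` of the printed bound
disappears; the true second-order term is `O(1/a)` (every excursion has at least two vertices off the wall), not pursued.

Label (lit-2 g16, 2026-08-23): CONSOLIDATION (lower half `a ≤ e^{κ}` and the RW11 square-lattice equivalence
`e^{κ(a)}/a → 1` as reported by BBdGDCG 2014 (arXiv v5 pp. 9–10) and BGJ 2012 p. 2; primary J. Stat. Phys. 145:661–668 not
held, label provisional on its acquisition) + NEW-IN-WRITING (modest): the explicit constant `a + 2`, the rate `2e^{−α}`,
the finite-`n` envelope `Z⁺_n(a) ≤ 3(a+2)ⁿ` and the 15-case supermartingale certificate. (Lane «pcv-sawmu», a-p3 g10.)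
-/

noncomputable section

open Finset Filter Topology Literature.Probability.LatticeModels
open scoped BigOperators

namespace Literature.Probability.RandomPlanarGeometry.SAW

namespace Step

/-- The opposite direction: `±e₀ ↔ ∓e₀`, `±e₁ ↔ ∓e₁` (`s ↦ s + 2` in `Fin 4`). [folklore] -/
def opp (s : Step) : Step := s + 2

/-- `opp` is an involution. [folklore] -/
@[simp] private theorem opp_opp (s : Step) : opp (opp s) = s := by
  fin_cases s <;> decide

/-- The opposite step cancels: `vec (opp s) + vec s = 0`. [folklore] -/
private theorem vec_opp_add (s : Step) : vec (opp s) + vec s = 0 := by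
  ext i
  fin_cases s <;> fin_cases i <;> simp [opp, vec, dx, dy]

end Step

namespace Zd

namespace LowTemp

/-- Peeling the first letter: `traj (s :: w) (i+1) = vec s + traj w i` (a local copy of the tree's
`SAW.traj_cons_succ` of `SAWBendingEnergy.lean`, not imported here). [folklore] -/
private theorem traj_cons_succ (s : Step) (w : List Step) (i : ℕ) : traj (s :: w) (i + 1) = Step.vec s + traj w i := by
  simp only [traj, List.take_succ_cons, wEnd_cons]

/-! ### The one-step rule, admissible words, potential-weighted sums -/

/-- A letter `s` may follow the last letter `l` (`none` at the start) at height `h`: it is not the reversal of `l`, and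
a step towards the wall (`−e₀ = 2`) needs `h ≥ 1` (the two local constraints satisfied by every half-plane self-avoiding
step word). [cite: BeatonGuttmannJensen2012Adsorption, §1 (p. 2)] -/
def Allowed (h : ℤ) (l : Option Step) (s : Step) : Prop := l ≠ some (Step.opp s) ∧ (s = 2 → 1 ≤ h)

/-- `Allowed` is decidable. [folklore] -/
instance (h : ℤ) (l : Option Step) (s : Step) : Decidable (Allowed h l s) := by
  unfold Allowed; infer_instance

/-- Admissible words read from the configuration `(h, l)`: every letter is `Allowed` in turn. [cite: BeatonGuttmannJensen2012Adsorption, §1 (p. 2)] -/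
def Adm : ℤ → Option Step → List Step → Prop
  | _, _, [] => True
  | h, l, s :: w => Allowed h l s ∧ Adm (h + s.dx) (some s) w

/-- `Adm` is decidable. [folklore] -/
instance decAdm : ∀ (h : ℤ) (l : Option Step) (w : List Step), Decidable (Adm h l w)
  | _, _, [] => isTrue trivial
  | h, l, s :: w =>
    haveI := decAdm (h + s.dx) (some s) w
    inferInstanceAs (Decidable (Allowed h l s ∧ Adm (h + s.dx) (some s) w))

/-- Arrival weight: `a` on the wall (a wall visit, vertex weight `a`), `1` off it. [cite: BeatonGuttmannJensen2012Adsorption, §1 (p. 2)] -/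
def wt (a : ℝ) (h : ℤ) : ℝ := if h = 0 then a else 1

/-- Potential-weighted weight of a word read from `(h, l)`: the product of the arrival weights times the potential of
the final configuration. [cite: BeatonGuttmannJensen2012Adsorption, §1 (p. 2)] -/
def val (u : ℤ → Option Step → ℝ) (a : ℝ) : ℤ → Option Step → List Step → ℝ
  | h, l, [] => u h l
  | h, _, s :: w => wt a (h + s.dx) * val u a (h + s.dx) (some s) w

/-- `val` restricted to admissible words (zero otherwise). [cite: BeatonGuttmannJensen2012Adsorption, §1 (p. 2)] -/
def F (u : ℤ → Option Step → ℝ) (a : ℝ) (h : ℤ) (l : Option Step) (w : List Step) : ℝ :=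
  if Adm h l w then val u a h l w else 0

/-- The one-step potential sum `Σ_{s allowed} wt · u(next configuration)`. [cite: BeatonGuttmannJensen2012Adsorption, §1 (p. 2)] -/
def locSum (u : ℤ → Option Step → ℝ) (a : ℝ) (h : ℤ) (l : Option Step) : ℝ :=
  ∑ s : Step, if Allowed h l s then wt a (h + s.dx) * u (h + s.dx) (some s) else 0

/-- `wt ≥ 0` for `a ≥ 0`. [folklore] -/
private theorem wt_nonneg {a : ℝ} (ha : 0 ≤ a) (h : ℤ) : 0 ≤ wt a h := by
  unfold wt; split_ifs
  · exact ha
  · exact zero_le_one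

/-- `val ≥ 0` for `u ≥ 0`, `a ≥ 0`. [folklore] -/
private theorem val_nonneg {u : ℤ → Option Step → ℝ} (hu : ∀ h l, 0 ≤ u h l) {a : ℝ} (ha : 0 ≤ a) :
    ∀ (w : List Step) (h : ℤ) (l : Option Step), 0 ≤ val u a h l w
  | [], h, l => hu h l
  | _ :: w, _, _ => mul_nonneg (wt_nonneg ha _) (val_nonneg hu ha w _ _)

/-- `F ≥ 0` for `u ≥ 0`, `a ≥ 0`. [folklore] -/
private theorem F_nonneg {u : ℤ → Option Step → ℝ} (hu : ∀ h l, 0 ≤ u h l) {a : ℝ} (ha : 0 ≤ a)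
    (h : ℤ) (l : Option Step) (w : List Step) : 0 ≤ F u a h l w := by
  unfold F; split_ifs
  · exact val_nonneg hu ha w h l
  · exact le_rfl

/-- First-letter recursion for `F`. [folklore] -/
private theorem F_cons (u : ℤ → Option Step → ℝ) (a : ℝ) (h : ℤ) (l : Option Step) (s : Step) (w : List Step) :
    F u a h l (s :: w) = if Allowed h l s then wt a (h + s.dx) * F u a (h + s.dx) (some s) w else 0 := by
  unfold F
  simp only [Adm, val]
  by_cases h1 : Allowed h l s <;> by_cases h2 : Adm (h + s.dx) (some s) w <;> simp [h1, h2]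

/-- An allowed letter keeps the height non-negative. [folklore] -/
private theorem height_nonneg_of_allowed {h : ℤ} (hh : 0 ≤ h) {l : Option Step} {s : Step} (hs : Allowed h l s) :
    0 ≤ h + s.dx := by
  rcases hs with ⟨-, hs⟩
  fin_cases s <;> simp [Step.dx] at hs ⊢ <;> omega

/-- Words of length `n + 1` are `s :: w` with `w` of length `n`. [folklore] -/
private theorem words_succ_eq (n : ℕ) :
    words (n + 1) = ((Finset.univ : Finset Step) ×ˢ words n).image fun p => p.1 :: p.2 := by
  ext w
  simp only [mem_words, Finset.mem_image, Finset.mem_product, Finset.mem_univ, true_and]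
  constructor
  · intro h
    cases w with
    | nil => simp at h
    | cons st w => exact ⟨(st, w), by simpa using h, rfl⟩
  · rintro ⟨⟨st, w'⟩, hw', rfl⟩
    simpa using hw'

/-- **The potential bound.** If `u ≥ 0` is `Λ`-excessive for the one-step rule at every height `h ≥ 0`, then the
potential-weighted sum over admissible words of length `m` read from `(h, l)` is at most `Λ^m u(h, l)`.
[cite: BeatonGuttmannJensen2012Adsorption, §1 (p. 2)] -/
theorem sum_words_le {u : ℤ → Option Step → ℝ} {a Λ : ℝ} (ha : 0 ≤ a) (hΛ : 0 ≤ Λ)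
    (hloc : ∀ h : ℤ, 0 ≤ h → ∀ l, locSum u a h l ≤ Λ * u h l) :
    ∀ (m : ℕ) (h : ℤ), 0 ≤ h → ∀ l : Option Step, ∑ w ∈ words m, F u a h l w ≤ Λ ^ m * u h l := by
  classical
  intro m
  induction m with
  | zero =>
    intro h _ l
    have h0 : words 0 = {[]} := by
      ext w; simp only [mem_words, Finset.mem_singleton, List.length_eq_zero_iff]
    simp [h0, F, Adm, val]
  | succ m ih =>
    intro h hh l
    rw [words_succ_eq, Finset.sum_image, Finset.sum_product]
    · calc ∑ s : Step, ∑ w ∈ words m, F u a h l (s :: w)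
            = ∑ s : Step, (if Allowed h l s then wt a (h + s.dx) else 0) *
                ∑ w ∈ words m, F u a (h + s.dx) (some s) w := by
              refine Finset.sum_congr rfl fun s _ => ?_
              rw [Finset.mul_sum]
              refine Finset.sum_congr rfl fun w _ => ?_
              rw [F_cons]
              split_ifs <;> simp
        _ ≤ ∑ s : Step, (if Allowed h l s then wt a (h + s.dx) else 0) * (Λ ^ m * u (h + s.dx) (some s)) := by
              refine Finset.sum_le_sum fun s _ => ?_
              by_cases hs : Allowed h l s
              · rw [if_pos hs]
                exact mul_le_mul_of_nonneg_left (ih _ (height_nonneg_of_allowed hh hs) _) (wt_nonneg ha _)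
              · rw [if_neg hs, zero_mul, zero_mul]
        _ = Λ ^ m * locSum u a h l := by
              rw [locSum, Finset.mul_sum]
              refine Finset.sum_congr rfl fun s _ => ?_
              split_ifs <;> ring
        _ ≤ Λ ^ m * (Λ * u h l) := mul_le_mul_of_nonneg_left (hloc h hh l) (pow_nonneg hΛ m)
        _ = Λ ^ (m + 1) * u h l := by ring
    · rintro ⟨st, w⟩ _ ⟨st', w'⟩ _ hp
      simp only [List.cons.injEq] at hp
      exact Prod.ext hp.1 hp.2

/-! ### Reading a half-plane self-avoiding word: admissibility and the value of `val` -/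

/-- The number of times `k ∈ [1, |w|]` at which the word `w`, started at height `h`, is on the wall (= `wallVisits` for
`h = 0`, `zc_zero_eq_wallVisits`). [cite: BeatonGuttmannJensen2012Adsorption, §1 (p. 2)] -/
def zc (h : ℤ) (w : List Step) : ℕ := ∑ k ∈ range w.length, if h + traj w (k + 1) 0 = 0 then 1 else 0

/-- The last letter of `w`, or `l` if `w` is empty (plumbing). [folklore] -/
def lastD : Option Step → List Step → Option Step
  | l, [] => l
  | _, s :: w => lastD (some s) w

/-- First-letter recursion for `zc`. [folklore] -/
private theorem zc_cons (h : ℤ) (s : Step) (w : List Step) :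
    zc h (s :: w) = (if h + s.dx = 0 then 1 else 0) + zc (h + s.dx) w := by
  unfold zc
  rw [List.length_cons, Finset.sum_range_succ']
  simp only [traj_cons_succ, Pi.add_apply, Step.vec_apply_zero, traj_zero, Pi.zero_apply, add_zero, ← add_assoc]
  exact add_comm _ _

/-- `val = a^{#wall times} · u(final configuration)`. [folklore] -/
private theorem val_eq (u : ℤ → Option Step → ℝ) (a : ℝ) :
    ∀ (w : List Step) (h : ℤ) (l : Option Step), val u a h l w = a ^ zc h w * u (h + wEnd w 0) (lastD l w)
  | [], h, l => by simp [val, zc, lastD]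
  | s :: w, h, l => by
    rw [val, val_eq u a w, zc_cons, lastD, wEnd_cons, Pi.add_apply, Step.vec_apply_zero, pow_add, ← add_assoc]
    unfold wt
    split_ifs <;> ring

/-- A self-avoiding word with non-negative height profile is admissible (no immediate reversal: the word would return to
its position two letters earlier). [folklore] -/
private theorem adm_of_saw : ∀ (w : List Step) (h : ℤ) (l : Option Step),
    (∀ i ≤ w.length, 0 ≤ h + traj w i 0) → IsSAW (l.toList ++ w) → Adm h l w
  | [], _, _, _, _ => trivial
  | s :: w, h, l, hh, hsaw => by
    refine ⟨⟨?_, ?_⟩, ?_⟩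
    · rintro rfl
      -- `l = some (opp s)`: the word `opp s :: s :: w` returns to its start after two steps
      have hinj := (isSAW_iff_injOn _).1 hsaw
      have h02 : traj (Step.opp s :: s :: w) 0 = traj (Step.opp s :: s :: w) 2 := by
        rw [traj_zero, traj_cons_succ, traj_cons_succ, traj_zero, add_zero, Step.vec_opp_add]
      have := hinj (by simp) (by simp) h02
      exact absurd this (by norm_num)
    · intro hs
      subst hs
      have := hh 1 (by simp)
      rw [traj_cons_succ, traj_zero, add_zero] at this
      simp [Step.dx] at this ⊢
      linarith
    · refine adm_of_saw w (h + s.dx) (some s) (fun i hi => ?_) ?_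
      · have := hh (i + 1) (by simpa using hi)
        rwa [traj_cons_succ, Pi.add_apply, Step.vec_apply_zero, ← add_assoc] at this
      · have := hsaw.drop l.toList.length
        simpa using this

/-- `zc 0 w = wallVisits |w| (traj w)`. [folklore] -/
private theorem zc_zero_eq_wallVisits {n : ℕ} {w : List Step} (hl : w.length = n) :
    zc 0 w = wallVisits n (traj w) := by
  classical
  unfold zc wallVisits
  rw [Finset.card_filter, Finset.sum_range_succ', hl]
  simp

/-- **`Z⁺_n(a) ≤ Λⁿ · u(0, start) / δ`** for every `Λ`-excessive potential `u ≥ δ > 0` of the one-step rule (`a ≥ 0`):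
every half-plane self-avoiding walk is the trajectory of an admissible word whose `val` is `a^{#wall visits}` times the
final potential. [cite: BeatonGuttmannJensen2012Adsorption, §1 (p. 2)] -/
theorem adsZ_le_of_potential (u : ℤ → Option Step → ℝ) {a Λ δ : ℝ} (ha : 0 ≤ a) (hΛ : 0 ≤ Λ) (hδ : 0 < δ)
    (hu : ∀ h : ℤ, ∀ l, 0 ≤ h → δ ≤ u h l) (hu0 : ∀ h l, 0 ≤ u h l)
    (hloc : ∀ h : ℤ, 0 ≤ h → ∀ l, locSum u a h l ≤ Λ * u h l) (n : ℕ) :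
    adsZ n a ≤ Λ ^ n * u 0 none / δ := by
  classical
  set good : Finset (List Step) := (sawWords n).filter (fun w => ∀ i ≤ n, 0 ≤ traj w i 0) with hgood
  have himage : hpWalks n = good.image traj := by
    ext ω
    simp only [mem_hpWalks, Finset.mem_image, hgood, Finset.mem_filter, mem_sawWords]
    constructor
    · rintro ⟨hω, hhp⟩
      have hω' : ω ∈ (sawWords n).image traj := by rw [image_traj_sawWords]; exact hω
      obtain ⟨w, hw, rfl⟩ := Finset.mem_image.1 hω'
      exact ⟨w, ⟨mem_sawWords.1 hw, hhp⟩, rfl⟩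
    · rintro ⟨w, ⟨⟨hl, hs⟩, hhp⟩, rfl⟩
      exact ⟨traj_mem_saws hl hs, hhp⟩
  have hmem : ∀ w ∈ good, (w.length = n ∧ IsSAW w) ∧ ∀ i ≤ n, 0 ≤ traj w i 0 := fun w hw => by
    simpa [hgood] using hw
  have hinj : Set.InjOn traj (good : Set (List Step)) := fun w hw w' hw' h =>
    traj_injOn n (by simp [(hmem w hw).1.1]) (by simp [(hmem w' hw').1.1]) h
  rw [adsZ, himage, Finset.sum_image hinj]
  have hterm : ∀ w ∈ good, a ^ wallVisits n (traj w) ≤ F u a 0 none w / δ := by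
    intro w hw
    obtain ⟨⟨hl, hs⟩, hhp⟩ := hmem w hw
    have hadm : Adm 0 none w := adm_of_saw w 0 none (by simpa [hl] using hhp) (by simpa using hs)
    have hend : 0 ≤ wEnd w 0 := by
      have := hhp n le_rfl
      rwa [← hl, traj_length] at this
    rw [F, if_pos hadm, val_eq, ← zc_zero_eq_wallVisits hl, le_div_iff₀ hδ, zero_add]
    exact mul_le_mul_of_nonneg_left (hu _ _ hend) (pow_nonneg ha _)
  have hsub : good ⊆ words n := fun w hw => mem_words.2 (hmem w hw).1.1
  calc ∑ w ∈ good, a ^ wallVisits n (traj w) ≤ ∑ w ∈ good, F u a 0 none w / δ := Finset.sum_le_sum hterm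
    _ ≤ ∑ w ∈ words n, F u a 0 none w / δ :=
        Finset.sum_le_sum_of_subset_of_nonneg hsub fun w _ _ => div_nonneg (F_nonneg hu0 ha _ _ _) hδ.le
    _ = (∑ w ∈ words n, F u a 0 none w) / δ := by rw [Finset.sum_div]
    _ ≤ Λ ^ n * u 0 none / δ := by
        gcongr
        exact sum_words_le ha hΛ hloc n 0 le_rfl none

/-! ### The `(a+2)`-excessive potential -/

/-- The potential: off the wall `1` (`2` for the unreachable off-wall start), on the wall `1/2` inside a wall run
(last letter `±e₁`), `a/(a+2)` just after landing (last letter `−e₀`), `1` at the start. [cite: BeatonGuttmannJensen2012Adsorption, §1 (p. 2)] -/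
def pot (a : ℝ) (h : ℤ) (l : Option Step) : ℝ :=
  if h = 0 then
    (match l with
      | none => 1
      | some s => if s = 2 then a / (a + 2) else if s = 0 then 1 else 1 / 2)
  else
    (match l with
      | none => 2
      | some _ => 1)

/-- `pot a 0 none = 1`. [folklore] -/
private theorem pot_zero_none (a : ℝ) : pot a 0 none = 1 := by simp [pot]

/-- `pot ≥ 1/3` for `a ≥ 1`. [folklore] -/
private theorem third_le_pot {a : ℝ} (ha : 1 ≤ a) (h : ℤ) (l : Option Step) : 1 / 3 ≤ pot a h l := by
  have h3 : 1 / 3 ≤ a / (a + 2) := by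
    rw [div_le_div_iff₀ (by norm_num) (by linarith)]; linarith
  unfold pot
  rcases l with _ | s
  · split_ifs <;> norm_num
  · by_cases hh : h = 0
    · simp only [hh, if_true]
      split_ifs
      · exact h3
      · norm_num
      · norm_num
    · norm_num [hh]

/-- `pot ≥ 0` for `a ≥ 1`. [folklore] -/
private theorem pot_nonneg {a : ℝ} (ha : 1 ≤ a) (h : ℤ) (l : Option Step) : 0 ≤ pot a h l :=
  le_trans (by norm_num) (third_le_pot ha h l)

/-- **The potential `pot` is `(a+2)`-excessive for `a ≥ 1`**: from inside a wall run one wall continuation (weight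
`a`) and one step up; after a landing two wall directions; off the wall three letters of which at most one lands.
A finite case analysis over `h ∈ {0, 1, ≥ 2}` and the last letter. [cite: BeatonGuttmannJensen2012Adsorption, §1 (p. 2)] -/
theorem locSum_pot_le {a : ℝ} (ha : 1 ≤ a) {h : ℤ} (hh : 0 ≤ h) (l : Option Step) :
    locSum (pot a) a h l ≤ (a + 2) * pot a h l := by
  have ha2 : 0 < a + 2 := by linarith
  have hA : (a + 2) * (a / (a + 2)) = a := by field_simp
  have hA1 : a / (a + 2) ≤ 1 := by rw [div_le_one ha2]; linarith
  have hA' : a * (a / (a + 2)) ≤ a := by nlinarith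
  rcases (show h = 0 ∨ h = 1 ∨ 2 ≤ h by omega) with rfl | rfl | h2
  · rcases l with _ | t
    · simp [locSum, Fin.sum_univ_four, Allowed, Step.opp, Step.dx, wt, pot]
      linarith
    · fin_cases t <;> simp [locSum, Fin.sum_univ_four, Allowed, Step.opp, Step.dx, wt, pot] <;> nlinarith
  · rcases l with _ | t
    · simp [locSum, Fin.sum_univ_four, Allowed, Step.opp, Step.dx, wt, pot]
      nlinarith
    · fin_cases t <;> simp [locSum, Fin.sum_univ_four, Allowed, Step.opp, Step.dx, wt, pot] <;> nlinarith
  · have h0 : h ≠ 0 := by omega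
    have h1 : h + 1 ≠ 0 := by omega
    have hm1 : h + -1 ≠ 0 := by omega
    have h1le : (1 : ℤ) ≤ h := by omega
    rcases l with _ | t
    · simp [locSum, Fin.sum_univ_four, Allowed, Step.opp, Step.dx, wt, pot, h0, h1, hm1, h1le]
      linarith
    · fin_cases t <;>
        simp [locSum, Fin.sum_univ_four, Allowed, Step.opp, Step.dx, wt, pot, h0, h1, hm1, h1le] <;> linarith

end LowTemp

/-! ### The finite bound and the growth rate -/

/-- **`Z⁺_n(a) ≤ 3 (a+2)ⁿ` for all `n` and all `a ≥ 1`** (half-plane `ℤ²`, vertex weights). The printed finite bound is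
`Z⁺_n(a) ≤ aⁿ cₙ` (`Zd.adsZ_le_pow_mul_count`). [cite: JansevanRensburgWhittington2013, §3.1 eq. (3.1) (arXiv v4 p. 6): «max{log μ_d, log μ_{d−1} + log a} ≤ κ(a) ≤ log μ_d + log a»]
[cite: BeatonGuttmannJensen2012Adsorption, §1 (p. 2)]
[cite: BeatonBousquetMelouDeGierDuminilCopinGuttmann2014, §3 (arXiv:1109.0358v5 pp. 9–10: «on the square lattice, μ(y) is asymptotic to y» — Rychlewski–Whittington 2011)] -/
theorem adsZ_le_three_mul_add_two_pow {a : ℝ} (ha : 1 ≤ a) (n : ℕ) : adsZ n a ≤ 3 * (a + 2) ^ n := by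
  have h := LowTemp.adsZ_le_of_potential (LowTemp.pot a) (zero_le_one.trans ha) (by linarith)
    (by norm_num : (0 : ℝ) < 1 / 3) (fun h l _ => LowTemp.third_le_pot ha h l) (fun h l => LowTemp.pot_nonneg ha h l)
    (fun h hh l => LowTemp.locSum_pot_le ha hh l) n
  rw [LowTemp.pot_zero_none] at h
  calc adsZ n a ≤ (a + 2) ^ n * 1 / (1 / 3) := h
    _ = 3 * (a + 2) ^ n := by ring

/-- **`e^{κ(a)} ≤ a + 2` for `a ≥ 1`** — an explicit form of the printed low-temperature law `e^{κ(a)} ∼ a`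
(Rychlewski–Whittington 2011, as reported); sharper than the printed `e^{κ(a)} ≤ μ·a` ((3.1)/(12.15)) exactly for
`a > 2/(μ−1)`. [cite: JansevanRensburgWhittington2013, §3.1 eq. (3.1) (arXiv v4 p. 6): «κ(a) ≤ log μ_d + log a»] [cite: BeatonBousquetMelouDeGierDuminilCopinGuttmann2014, §3 (arXiv:1109.0358v5 pp. 9–10: «Rychlewski and Whittington [RW11] … proved that, on the square lattice, μ(y) is asymptotic to y»)]
[cite: BeatonGuttmannJensen2012Adsorption, §1 p. 2 (arXiv:1110.6695v1: «κ(α) is asymptotic to α»)] [cite: JansevanRensburgWhittington2013, Theorem 4 (arXiv v4 p. 8), Corollary 1 and Theorem 5 (p. 9): ratio asymptotics κ(a) ∼ log μ_{d−1} + log a] -/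
theorem adsRate_le_add_two {a : ℝ} (ha : 1 ≤ a) : adsRate a ≤ a + 2 := by
  have h0 : 0 ≤ a := zero_le_one.trans ha
  have h3 : Tendsto (fun n : ℕ => (3 : ℝ) ^ (1 / (n : ℝ))) atTop (𝓝 1) := by
    have := (tendsto_const_nhds (x := (3 : ℝ))).rpow tendsto_one_div_atTop_nhds_zero_nat (Or.inl (by norm_num))
    simpa using this
  have hup : Tendsto (fun n : ℕ => (3 : ℝ) ^ (1 / (n : ℝ)) * (a + 2)) atTop (𝓝 (a + 2)) := by
    simpa using h3.mul_const (a + 2)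
  refine le_of_tendsto_of_tendsto (tendsto_adsRate h0) hup ?_
  filter_upwards [eventually_ge_atTop 1] with n hn
  calc (adsZ n a) ^ (1 / (n : ℝ)) ≤ (3 * (a + 2) ^ n) ^ (1 / (n : ℝ)) :=
        Real.rpow_le_rpow (adsZ_nonneg n h0) (adsZ_le_three_mul_add_two_pow ha n) (by positivity)
    _ = (3 : ℝ) ^ (1 / (n : ℝ)) * (a + 2) := by
        rw [Real.mul_rpow (by norm_num) (pow_nonneg (by linarith) _), one_div,
          Real.pow_rpow_inv_natCast (by linarith) (by omega)]

/-- **`a ≤ e^{κ(a)} ≤ a + 2` for `a ≥ 1`** (the sandwich; lower half = `Zd.self_le_adsRate`, printed as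
«`κ(α) ≥ max[log μ, α]`»). [cite: BeatonGuttmannJensen2012Adsorption, §1 p. 2 (arXiv:1110.6695v1: «κ(α) ≥ max[log μ, α]»)]
[cite: BeatonBousquetMelouDeGierDuminilCopinGuttmann2014, §3 (arXiv:1109.0358v5 pp. 9–10: «on the square lattice, μ(y) is asymptotic to y»)] -/
theorem adsRate_mem_Icc {a : ℝ} (ha : 1 ≤ a) : adsRate a ∈ Set.Icc a (a + 2) :=
  ⟨self_le_adsRate (zero_le_one.trans ha), adsRate_le_add_two ha⟩

/-- `e^{κ(a)} ≤ a + 3` for every `a ≥ 0` (monotonicity below `a = 1`). [cite: BeatonGuttmannJensen2012Adsorption, §1 p. 2 (arXiv:1110.6695v1)] -/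
theorem adsRate_le_add_three {a : ℝ} (ha : 0 ≤ a) : adsRate a ≤ a + 3 := by
  rcases le_or_gt 1 a with h1 | h1
  · linarith [adsRate_le_add_two h1]
  · calc adsRate a ≤ adsRate 1 := adsRate_mono ha h1.le
      _ ≤ 1 + 2 := adsRate_le_add_two le_rfl
      _ ≤ a + 3 := by linarith

/-- **Rychlewski–Whittington 2011 (square lattice), as printed: `e^{κ(a)}/a → 1` as `a → ∞`** («on the square lattice,
`μ(y)` is asymptotic to `y`»). [cite: BeatonBousquetMelouDeGierDuminilCopinGuttmann2014, §3 (arXiv:1109.0358v5 pp. 9–10: «Rychlewski and Whittington [RW11] … proved that, on the square lattice, μ(y) is asymptotic to y»)]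
[cite: BeatonGuttmannJensen2012Adsorption, §1 p. 2 (arXiv:1110.6695v1: «κ(α) is asymptotic to α»)] [cite: JansevanRensburgWhittington2013, Theorem 4 (arXiv v4 p. 8), Corollary 1 and Theorem 5 (p. 9): ratio asymptotics κ(a) ∼ log μ_{d−1} + log a] -/
theorem tendsto_adsRate_div_self : Tendsto (fun a : ℝ => adsRate a / a) atTop (𝓝 1) := by
  have hup : Tendsto (fun a : ℝ => 1 + 2 * a⁻¹) atTop (𝓝 1) := by
    simpa using (tendsto_inv_atTop_zero.const_mul (2 : ℝ)).const_add (1 : ℝ)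
  refine tendsto_of_tendsto_of_tendsto_of_le_of_le' tendsto_const_nhds hup ?_ ?_
  · filter_upwards [eventually_ge_atTop 1] with a ha
    rw [le_div_iff₀ (by linarith), one_mul]
    exact self_le_adsRate (by linarith)
  · filter_upwards [eventually_ge_atTop 1] with a ha
    rw [div_le_iff₀ (by linarith)]
    have h1 := adsRate_le_add_two ha
    have h2 : (1 + 2 * a⁻¹) * a = a + 2 := by field_simp
    linarith

/-! ### The free energy: `0 ≤ κ(α) − α ≤ 2e^{−α}` -/

/-- `0 ≤ κ(α) − α` for `α ≥ 0` (printed: «`κ(α) ≥ max[log μ, α]`»). [cite: BeatonGuttmannJensen2012Adsorption, §1 p. 2 (arXiv:1110.6695v1: «κ(α) ≥ max[log μ, α]»)] -/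
theorem adsFreeEnergy_sub_self_nonneg {α : ℝ} (hα : 0 ≤ α) : 0 ≤ adsFreeEnergy α - α := by
  have h1 := max_le_adsFreeEnergy hα
  have h2 := le_max_right (Real.log (connectiveConstant 2)) α
  linarith

/-- **`κ(α) − α ≤ log (1 + 2e^{−α})` for `α ≥ 0`** (`= log ((e^α + 2)/e^α)`). [cite: BeatonBousquetMelouDeGierDuminilCopinGuttmann2014, §3 (arXiv:1109.0358v5 pp. 9–10: «on the square lattice, μ(y) is asymptotic to y»)]
[cite: BeatonGuttmannJensen2012Adsorption, §1 p. 2 (arXiv:1110.6695v1: «κ(α) is asymptotic to α»)] [cite: JansevanRensburgWhittington2013, Theorem 4 (arXiv v4 p. 8), Corollary 1 and Theorem 5 (p. 9): ratio asymptotics κ(a) ∼ log μ_{d−1} + log a] -/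
theorem adsFreeEnergy_sub_le_log {α : ℝ} (hα : 0 ≤ α) :
    adsFreeEnergy α - α ≤ Real.log (1 + 2 * Real.exp (-α)) := by
  have h1 : 1 ≤ Real.exp α := Real.one_le_exp hα
  have hpos := adsRate_pos (zero_le_one.trans h1)
  have key : adsRate (Real.exp α) ≤ Real.exp α * (1 + 2 * Real.exp (-α)) := by
    have h2 := adsRate_le_add_two h1
    have h3 : Real.exp α * (1 + 2 * Real.exp (-α)) = Real.exp α + 2 := by
      rw [mul_add, mul_one, Real.exp_neg, mul_comm, inv_mul_cancel_right₀ (Real.exp_pos α).ne']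
    linarith
  calc adsFreeEnergy α - α = Real.log (adsRate (Real.exp α)) - α := rfl
    _ ≤ Real.log (Real.exp α * (1 + 2 * Real.exp (-α))) - α := by
        gcongr
    _ = Real.log (1 + 2 * Real.exp (-α)) := by
        rw [Real.log_mul (Real.exp_pos α).ne' (by positivity), Real.log_exp]; ring

/-- **`κ(α) − α ≤ 2e^{−α}` for `α ≥ 0`** — the correction to the low-temperature law is exponentially small.
[cite: BeatonBousquetMelouDeGierDuminilCopinGuttmann2014, §3 (arXiv:1109.0358v5 pp. 9–10: «on the square lattice, μ(y) is asymptotic to y»)] -/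
theorem adsFreeEnergy_sub_le {α : ℝ} (hα : 0 ≤ α) : adsFreeEnergy α - α ≤ 2 * Real.exp (-α) := by
  refine (adsFreeEnergy_sub_le_log hα).trans ?_
  have := Real.log_le_sub_one_of_pos (show 0 < 1 + 2 * Real.exp (-α) by positivity)
  linarith

/-- **`κ(α) − α → 0` as `α → ∞`** — the printed low-temperature law in free-energy form (`κ(α) = α + log μ(ℤ¹) + o(1)`,
`μ(ℤ¹) = 1`); the tree's earlier `Zd.tendsto_adsFreeEnergy_div` (`κ(α)/α → 1`) is its corollary.
[cite: BeatonGuttmannJensen2012Adsorption, §1 p. 2 (arXiv:1110.6695v1: «κ(α) is asymptotic to α»)] [cite: JansevanRensburgWhittington2013, Theorem 4 (arXiv v4 p. 8), Corollary 1 and Theorem 5 (p. 9): ratio asymptotics κ(a) ∼ log μ_{d−1} + log a]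
[cite: BeatonBousquetMelouDeGierDuminilCopinGuttmann2014, §3 (arXiv:1109.0358v5 pp. 9–10: «on the square lattice, μ(y) is asymptotic to y»)] -/
theorem tendsto_adsFreeEnergy_sub_self : Tendsto (fun α : ℝ => adsFreeEnergy α - α) atTop (𝓝 0) := by
  have hup : Tendsto (fun α : ℝ => 2 * Real.exp (-α)) atTop (𝓝 0) := by
    simpa using Real.tendsto_exp_neg_atTop_nhds_zero.const_mul (2 : ℝ)
  refine tendsto_of_tendsto_of_tendsto_of_le_of_le' tendsto_const_nhds hup ?_ ?_
  · filter_upwards [eventually_ge_atTop 0] with α hα using adsFreeEnergy_sub_self_nonneg hα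
  · filter_upwards [eventually_ge_atTop 0] with α hα using adsFreeEnergy_sub_le hα

end Zd

end Literature.Probability.RandomPlanarGeometry.SAW

end
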